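import Literature.NumberTheory.DiophantineGeometry.FaltingsHeightJInvariant
import Mathlib.NumberTheory.Height.NumberField
import Mathlib.NumberTheory.NumberField.ProductFormula
import Mathlib.NumberTheory.ModularForms.LevelOne.GradedRing
import Mathlib.NumberTheory.ModularForms.EisensteinSeries.QExpansion
import Mathlib.NumberTheory.Modular
import Mathlib.MeasureTheory.Measure.Lebesgue.Complex
import Mathlib.NumberTheory.LSeries.HurwitzZetaValues
import Mathlib.Analysis.Convex.SpecificFunctions.Basic
import Mathlib.Analysis.Convex.Jensen
import HarnessLib

/-!
# Silverman 1986, Prop. 2.1 (`h(j_E)` versus `12 h(E/K)`) — proofs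

Topic `NumberTheory/DiophantineGeometry`; sibling PROOFS file of `FaltingsHeightJInvariant.lean`,
discharging its named fact (D-0014):

* `silverman1986_jHeight_faltingsHeight_holds : silverman1986_jHeight_faltingsHeight` — there are
  absolute constants `C₁, C₂` with
  `C₁ ≤ {h(j_E) + [K:ℚ]⁻¹ log N Υ_{E/K}} − 12 h(E/K) ≤ 6 log(1 + h(j_E)) + C₂`
  for every elliptic curve `E` over every number field `K` (all notation as in the fact:
  `h(E/K) = faltingsHeight`, `h(j_E) = [K:ℚ]⁻¹ logHeight₁ j`, `log N Υ = log N Δ_{E/K} − log N 𝔇`).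

No new definitions, no new named facts (D-0026); the analytic helpers are `private`.

**Source (held as `book:cornellnd-arithmetic-geometry`, pdf pp. 330–334 = printed pp. 254–258,
read).** J. H. Silverman, *Heights and elliptic curves*, in: Arithmetic Geometry
(Cornell–Silverman eds.), Springer 1986, Ch. X: Prop. 1.1 and §2, eqs. (4)–(12), Prop. 2.1.

## The printed proof and its formalisation

Write `n = [K:ℚ]`, `𝔇 = jDenominatorIdeal` and `A_σ = faltingsArchTerm (W.map σ)`
(`= log|σ Δ_W| + 6 log((i/2)∫ ω ∧ ω̄)`) for `σ : K → ℂ`. By the closed formula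
`12 h(E/K) = n⁻¹ (log N Δ_{E/K} − Σ_σ A_σ)` (`WeierstrassCurve.faltingsHeight`) the quantity of
Prop. 2.1 is `n⁻¹ (log H_K(j) − log N𝔇 + Σ_σ A_σ)` — this is Silverman's passage from (8) to (9).

1. **Eq. (10)**, `H_K(j) = N(𝔇) ∏_{v∣∞} max(|j|_v, 1)^{n_v}` (`mulHeight₁_j_eq_absNorm_mul_prod`):
   write `j = a/b` with `a, b ∈ 𝓞_K`; Mathlib's `mulHeight₁ (a/b) = mulHeight ![a, b]`, its
   finite part is `N((a, b))⁻¹` (`NumberField.absNorm_mul_finprod_finitePlace_eq_one`), its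
   infinite part is `|N(b)| ∏ max(|j|_v,1)^{n_v}` (`InfinitePlace.prod_eq_abs_norm`), and
   `𝔇 · (a, b) = (b)` in the Dedekind domain `𝓞_K` (`jDenominatorIdeal_mul_span_pair`). Grouping
   the complex embeddings by places (`card_filter_mk_eq`) gives
   `log H_K(j) = log N𝔇 + Σ_σ log max(|σ j|, 1)` (`logHeight₁_j_eq_sum_embeddings`), so the
   quantity is `n⁻¹ Σ_σ F(E_σ)` with `F(V) = log max(|j_V|, 1) + log|Δ_V| + 6 log((i/2)∫ ω_V ∧ ω̄_V)`
   for a complex elliptic curve `V`.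
2. **Eqs. (4)–(7)** (`exists_bounds_log_max_j_add_faltingsArchTerm`): absolute `C₁, C₂` with
   `C₁ ≤ F(V) ≤ 6 log(1 + log max(|j_V|, 1)) + C₂`. By uniformisation (the tree's
   `exists_periodPair_of_isElliptic'`, `complexPeriod_eq_two_mul_covolume'`) and reduction of the
   period lattice to `ω(ℤτ + ℤ)` with `Im τ ≥ 1/2` (`exists_normalForm`, via
   `ModularGroup.exists_one_half_le_im_smul`; Silverman uses the fundamental domain, any
   `Im τ ≥ 1/2` region does as well) one has `c₄ = 16π⁴ω⁻⁴E₄(τ)`, `Δ_V = 2¹²π¹²ω⁻¹²Δ(τ)`,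
   `j_V = E₄(τ)³/Δ(τ)`, `(i/2)∫ω∧ω̄ = |ω|² Im τ`, whence (Prop. 1.1 at one place)
   `F(V) = log(2¹²π¹²) + log max(|Δ(τ)|, |E₄(τ)|³) + 6 log Im τ`. The `q`-disc estimates
   (`|Δ(τ)| ≤ K e^{−2π Im τ}`, `|Δ(τ)| ≥ m` on `Im τ ≤ Y`, `|E₄| ≥ 1/2` for `Im τ ≥ Y`, boundedness
   of `Δ, E₄`) are Silverman's (4), (5); they give `F ≥ C₁` and `Im τ ≤ A (1 + log max(|j_V|, 1))`,
   i.e. (6), (7). (These estimates are the same as in the tree's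
   `EllipticCurves/SilvermanHeightLogMaxProofs.lean`, where they are private; they are re-proved
   here for a curve over `ℂ` rather than a Néron lattice over `ℚ`.)
3. **Eqs. (11), (12)**: `n = #(K → ℂ)` (`NumberField.Embeddings.card`) gives the lower bound, and
   the arithmetic–geometric mean inequality, here Jensen for `log` (`ConcaveOn.le_map_sum` with
   `strictConcaveOn_log_Ioi`), gives `n⁻¹ Σ_σ 6 log(1 + log⁺|σ j|) ≤ 6 log(1 + n⁻¹ Σ_σ log⁺|σ j|)
   ≤ 6 log(1 + h(j))` since `log N𝔇 ≥ 0`.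

## References

* J. H. Silverman, *Heights and elliptic curves*, in Arithmetic Geometry (Cornell–Silverman
  eds.), Springer (1986) 253–265: Prop. 1.1 (p. 254), §2 eqs. (4)–(12) (pp. 256–257),
  Prop. 2.1 (p. 257). [Silverman1986]
* J. H. Silverman, *The Arithmetic of Elliptic Curves*, 2nd ed. (2009), VI.3.6, VI.5.1, C.12.
  [SilvermanAEC2009]
-/

noncomputable section

namespace Literature.NumberTheory.DiophantineGeometry

open _root_.NumberField _root_.WeierstrassCurve _root_.Height
open _root_.Complex _root_.UpperHalfPlane _root_.EisensteinSeries _root_.ModularForm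
open scoped MatrixGroups Real

/-! ### Eq. (10): the finite part of `H_K(j)` is `N(𝔇)` -/

section Height

variable {K : Type*} [Field K] [NumberField K] (W : WeierstrassCurve K) [W.IsElliptic]

omit [NumberField K] in
/-- Membership in `𝔇` when `j = a/b`: `c ∈ 𝔇 ↔ c a ∈ (b)`. [folklore] -/
private theorem mem_jDenominatorIdeal_iff_of_eq_div {a b : 𝓞 K} (hb : (b : K) ≠ 0)
    (hj : W.j = a / b) (c : 𝓞 K) :
    c ∈ W.jDenominatorIdeal ↔ ∃ d : 𝓞 K, c * a = d * b := by
  rw [mem_jDenominatorIdeal, hj]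
  constructor
  · rintro ⟨d, hd⟩
    refine ⟨d, ?_⟩
    rw [mul_div_assoc', div_eq_iff hb] at hd
    exact_mod_cast hd
  · rintro ⟨d, hd⟩
    refine ⟨d, ?_⟩
    have h := congrArg (fun x : 𝓞 K => (x : K)) hd
    push_cast at h
    rw [mul_div_assoc', h]
    field_simp

/-- **`𝔇 · (a, b) = (b)`** for `j = a/b` with `a, b ∈ 𝓞_K`: in the Dedekind domain `𝓞_K`,
`(a, b) ⊇ (b)` gives `(b) = (a, b) 𝔅` with `𝔅 ⊆ 𝔇`, while `𝔇 · (a, b) ⊆ (b)` directly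
(Silverman 1986, §2: `(j) = 𝔄𝔇⁻¹` with `𝔄, 𝔇` coprime integral ideals). [folklore] -/
private theorem jDenominatorIdeal_mul_span_pair {a b : 𝓞 K} (hb : (b : K) ≠ 0)
    (hj : W.j = a / b) :
    W.jDenominatorIdeal * Ideal.span {a, b} = Ideal.span {b} := by
  have hmem := mem_jDenominatorIdeal_iff_of_eq_div W hb hj
  have hbg : Ideal.span {b} ≤ Ideal.span {a, b} := Ideal.span_mono (by simp)
  obtain ⟨B, hB⟩ := Ideal.dvd_iff_le.mpr hbg
  have hBD : B ≤ W.jDenominatorIdeal := by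
    intro c hc
    have hac : a * c ∈ Ideal.span {b} := by
      rw [hB]
      exact Ideal.mul_mem_mul (Ideal.subset_span (by simp)) hc
    obtain ⟨d, hd⟩ := Ideal.mem_span_singleton'.mp hac
    exact (hmem c).mpr ⟨d, by rw [mul_comm, ← hd]⟩
  have hDg : W.jDenominatorIdeal * Ideal.span {a, b} ≤ Ideal.span {b} := by
    rw [Ideal.mul_le]
    intro c hc s hs
    obtain ⟨d, hd⟩ := (hmem c).mp hc
    obtain ⟨r, t, rfl⟩ := Ideal.mem_span_pair.mp hs
    rw [Ideal.mem_span_singleton']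
    exact ⟨r * d + t * c, by linear_combination (-r) * hd⟩
  refine le_antisymm hDg ?_
  calc Ideal.span {b} = Ideal.span {a, b} * B := hB
    _ ≤ Ideal.span {a, b} * W.jDenominatorIdeal := Ideal.mul_mono_right hBD
    _ = W.jDenominatorIdeal * Ideal.span {a, b} := mul_comm _ _

/-- `⨆ i, f (![x, y] i) = max (f x) (f y)` for a real-valued `f`. [folklore] -/
private theorem iSup_fin_two {α : Type*} (f : α → ℝ) (x y : α) :
    (⨆ i, f (![x, y] i)) = max (f x) (f y) := by
  refine le_antisymm (ciSup_le fun i => ?_) (max_le ?_ ?_)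
  · fin_cases i
    · exact le_max_left _ _
    · exact le_max_right _ _
  · exact Finite.le_ciSup_of_le 0 le_rfl
  · exact Finite.le_ciSup_of_le 1 le_rfl

/-- **Silverman 1986, §2 eq. (10)**: `H_K(j) = N(𝔇) · ∏_{v ∣ ∞} max(|j|_v, 1)^{n_v}` — the finite
part of the (relative) multiplicative height of `j` is the norm of its denominator ideal.
[cite: Silverman1986, §2 eq. (10) (p. 257)] -/
theorem mulHeight₁_j_eq_absNorm_mul_prod :
    mulHeight₁ W.j = (Ideal.absNorm W.jDenominatorIdeal : ℝ) *
      ∏ w : InfinitePlace K, (max (w W.j) 1) ^ w.mult := by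
  classical
  obtain ⟨a, b, hb, hab⟩ := IsFractionRing.div_surjective (A := 𝓞 K) W.j
  have hb0 : b ≠ 0 := nonZeroDivisors.ne_zero hb
  have hbK : (b : K) ≠ 0 := RingOfIntegers.coe_ne_zero_iff.mpr hb0
  have hj : W.j = a / b := hab.symm
  -- the pair `![a, b]`
  set x : Fin 2 → 𝓞 K := ![a, b] with hx
  have hx0 : x ≠ 0 := by
    intro h
    have : x 1 = 0 := by rw [h]; rfl
    exact hb0 this
  have hxK : ∀ i : Fin 2, ((x i : 𝓞 K) : K) = ![(a : K), (b : K)] i := by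
    intro i; fin_cases i <;> rfl
  have hx0' : (![(a : K), (b : K)] : Fin 2 → K) ≠ 0 := by
    intro h
    have : (![(a : K), (b : K)] : Fin 2 → K) 1 = 0 := by rw [h]; rfl
    exact hbK this
  -- finite part: `N(a, b) · ∏ᶠ_v max(|a|_v, |b|_v) = 1`
  have hfin := absNorm_mul_finprod_finitePlace_eq_one hx0
  have hrange : Ideal.span (Set.range x) = Ideal.span {a, b} := by
    rw [hx, Matrix.range_cons_cons_empty]
  rw [hrange] at hfin
  simp_rw [hxK, iSup_fin_two] at hfin
  -- the height of `j = a/b` is the height of the pair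
  rw [hj, mulHeight₁_div_eq_mulHeight, NumberField.mulHeight_eq hx0']
  simp_rw [iSup_fin_two]
  -- archimedean part: `max(|a|_w, |b|_w) = |b|_w · max(|j|_w, 1)`
  have harch : ∀ w : InfinitePlace K, max (w a) (w b) = w b * max (w ((a : K) / b)) 1 := by
    intro w
    have hwb : 0 < w b := w.pos_iff.mpr hbK  -- AbsoluteValue.pos_iff?
    rw [map_div₀, mul_max_of_nonneg _ _ hwb.le, mul_div_cancel₀ _ hwb.ne', mul_one]
  simp_rw [harch, mul_pow, Finset.prod_mul_distrib, InfinitePlace.prod_eq_abs_norm]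
  -- norms: `|N(b)| = N((b)) = N(𝔇) N((a,b))`
  have hnorm : ((|Algebra.norm ℚ (b : K)| : ℚ) : ℝ) =
      (Ideal.absNorm W.jDenominatorIdeal : ℝ) * Ideal.absNorm (Ideal.span {a, b}) := by
    rw [← Nat.cast_mul, ← map_mul, jDenominatorIdeal_mul_span_pair W hbK hj,
      Ideal.absNorm_span_singleton, ← Algebra.coe_norm_int, Rat.cast_abs, Rat.cast_intCast,
      Nat.cast_natAbs, Int.cast_abs]
  have hg0 : (Ideal.absNorm (Ideal.span {a, b}) : ℝ) ≠ 0 := by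
    rw [Nat.cast_ne_zero, Ne, Ideal.absNorm_eq_zero_iff]
    intro h
    have : b ∈ Ideal.span {a, b} := Ideal.subset_span (by simp)
    rw [h] at this
    exact hb0 this
  have hF : ∏ᶠ v : FinitePlace K, max (v (a : K)) (v (b : K)) =
      ((Ideal.absNorm (Ideal.span {a, b}) : ℝ))⁻¹ := by
    exact eq_inv_of_mul_eq_one_right hfin
  rw [hnorm, hF]
  field_simp

/-- Logarithmic form of eq. (10): `log H_K(j) = log N(𝔇) + Σ_{v ∣ ∞} n_v log max(|j|_v, 1)`.
[cite: Silverman1986, §2 eq. (10) (p. 257)] -/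
theorem logHeight₁_j_eq :
    logHeight₁ W.j = Real.log (Ideal.absNorm W.jDenominatorIdeal) +
      ∑ w : InfinitePlace K, (w.mult : ℝ) * Real.log (max (w W.j) 1) := by
  have hD : (Ideal.absNorm W.jDenominatorIdeal : ℝ) ≠ 0 := by
    rw [Nat.cast_ne_zero, Ne, Ideal.absNorm_eq_zero_iff]
    exact W.jDenominatorIdeal_ne_bot
  have hpos : ∀ w : InfinitePlace K, 0 < max (w W.j) 1 := fun w => lt_max_of_lt_right one_pos
  rw [logHeight₁_eq_log_mulHeight₁, mulHeight₁_j_eq_absNorm_mul_prod,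
    Real.log_mul hD (Finset.prod_pos fun w _ => pow_pos (hpos w) _).ne',
    Real.log_prod fun w _ => (pow_pos (hpos w) _).ne']
  congr 1
  refine Finset.sum_congr rfl fun w _ => ?_
  rw [Real.log_pow]

/-- `Σ_{v ∣ ∞} n_v f(|x|_v) = Σ_{σ : K → ℂ} f(|σ x|)`: each infinite place `v` is induced by
exactly `n_v` complex embeddings (Mathlib `card_filter_mk_eq`). [folklore] -/
theorem sum_mult_mul_eq_sum_embeddings (f : ℝ → ℝ) (x : K) :
    ∑ w : InfinitePlace K, (w.mult : ℝ) * f (w x) = ∑ σ : K →+* ℂ, f ‖σ x‖ := by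
  classical
  rw [← Finset.sum_fiberwise Finset.univ InfinitePlace.mk (fun φ : K →+* ℂ => f ‖φ x‖)]
  refine Finset.sum_congr rfl fun w _ => ?_
  have h : ∀ φ ∈ ({φ ∈ Finset.univ | InfinitePlace.mk φ = w} : Finset (K →+* ℂ)),
      f ‖φ x‖ = f (w x) := by
    intro φ hφ
    rw [← (Finset.mem_filter.mp hφ).2, InfinitePlace.apply]
  rw [Finset.sum_congr rfl h, Finset.sum_const, InfinitePlace.card_filter_mk_eq, nsmul_eq_mul]

/-- **Eq. (10) over the complex embeddings**: `log H_K(j_E) = log N(𝔇) + Σ_{σ : K → ℂ} log max(|σ j_E|, 1)`.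
[cite: Silverman1986, §2 eq. (10) (p. 257)] -/
theorem logHeight₁_j_eq_sum_embeddings :
    logHeight₁ W.j = Real.log (Ideal.absNorm W.jDenominatorIdeal) +
      ∑ σ : K →+* ℂ, Real.log (max ‖σ W.j‖ 1) := by
  rw [logHeight₁_j_eq, sum_mult_mul_eq_sum_embeddings (fun t => Real.log (max t 1))]


end Height

section Analytic

/-! ### Reduction of a period lattice to `ω(ℤτ + ℤ)`, `Im τ ≥ 1/2` -/

/-- `covol(ℤω₁ + ℤω₂) = |Re ω₁ Im ω₂ − Im ω₁ Re ω₂|` for Lebesgue measure on `ℂ` (the area of a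
fundamental parallelogram; Silverman 1986, proof of Prop. 1.1). [folklore] -/
private theorem covolume_lattice_eq (L : PeriodPair) :
    ZLattice.covolume L.lattice = |L.ω₁.re * L.ω₂.im - L.ω₁.im * L.ω₂.re| := by
  classical
  rw [ZLattice.covolume_eq_det_mul_measureReal L.lattice MeasureTheory.volume L.latticeBasis
    Complex.basisOneI]
  have h1 : MeasureTheory.volume.real (ZSpan.fundamentalDomain Complex.basisOneI) = 1 := by
    rw [MeasureTheory.measureReal_congr
      (ZSpan.fundamentalDomain_ae_parallelepiped Complex.basisOneI MeasureTheory.volume),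
      MeasureTheory.measureReal_def, ← Complex.toBasis_orthonormalBasisOneI,
      OrthonormalBasis.coe_toBasis, Complex.orthonormalBasisOneI.volume_parallelepiped]
    simp
  rw [h1, mul_one, Module.Basis.det_apply, Matrix.det_fin_two]
  simp only [Module.Basis.toMatrix_apply, Complex.coe_basisOneI_repr, Function.comp_apply,
    PeriodPair.latticeBasis_zero, PeriodPair.latticeBasis_one, Matrix.cons_val_zero,
    Matrix.cons_val_one]
  congr 1; ring

/-- The lattice sums `G_k(Λ) = ∑_{λ ∈ Λ} λ^{-k}` written over `ℤ²`. [folklore] -/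
private theorem G_eq_tsum_prod (L : PeriodPair) (k : ℕ) :
    L.G k = ∑' x : ℤ × ℤ, ((x.1 * L.ω₁ + x.2 * L.ω₂) ^ k)⁻¹ := by
  rw [PeriodPair.G, ← (Equiv.tsum_eq L.latticeEquivProd.symm.toEquiv
    (fun l : L.lattice => ((l : ℂ) ^ k)⁻¹))]
  congr with x
  simp [L.latticeEquiv_symm_apply]

/-- Reindexing `ℤ × ℤ ≃ (Fin 2 → ℤ)` in the Eisenstein summands. [folklore] -/
private theorem tsum_prod_eisSummand (k : ℤ) (τ : ℍ) :
    ∑' x : ℤ × ℤ, eisSummand k ![x.2, x.1] τ = ∑' v : Fin 2 → ℤ, eisSummand k v τ := by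
  rw [← Equiv.tsum_eq ((Equiv.prodComm ℤ ℤ).trans (finTwoArrowEquiv ℤ).symm)]
  rfl

/-- `∑_{(m,n) ∈ ℤ²} (mτ + n)^{-k} = 2ζ(k) E_k(τ)`. [folklore] -/
private theorem two_mul_zeta_mul_E_apply {k : ℕ} (hk : 3 ≤ k) (τ : ℍ) :
    2 * riemannZeta k * E hk τ = ∑' v : Fin 2 → ℤ, eisSummand k v τ := by
  rw [tsum_eisSummand_eq_riemannZeta_mul_eisensteinSeries hk,
    show E hk τ = (1 / 2 : ℂ) • eisensteinSeriesSIF (N := 1) 0 k τ from rfl,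
    eisensteinSeriesSIF_apply, smul_eq_mul]
  ring

/-- `G_k(ℤω₁ + ℤω₂) = ω₁^{-k} · 2ζ(k) E_k(ω₂/ω₁)` when `Im(ω₂/ω₁) > 0` (homogeneity of the
lattice sums; Silverman AEC C.12, Serre VII §2.2). [folklore] -/
private theorem G_eq_of_im_pos (L : PeriodPair) (h : 0 < (L.ω₂ / L.ω₁).im) {k : ℕ}
    (hk : 3 ≤ k) :
    L.G k = (L.ω₁ ^ k)⁻¹ * (2 * riemannZeta k * E hk (UpperHalfPlane.mk _ h)) := by
  have hω₁ : L.ω₁ ≠ 0 := by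
    rintro h0
    simp [h0] at h
  rw [two_mul_zeta_mul_E_apply, ← tsum_prod_eisSummand, G_eq_tsum_prod, ← tsum_mul_left]
  congr with x
  rw [eisSummand, zpow_neg, zpow_natCast, ← mul_inv, ← mul_pow]
  congr 2
  simp only [Matrix.cons_val_zero, Matrix.cons_val_one]
  field_simp
  ring

/-- `Im(b/a) · |a|² = Re a Im b − Im a Re b`. [folklore] -/
private theorem im_div_mul_normSq (a b : ℂ) (ha : a ≠ 0) :
    (b / a).im * Complex.normSq a = a.re * b.im - a.im * b.re := by
  rw [Complex.div_im]
  field_simp [(Complex.normSq_pos.mpr ha).ne']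

/-- Reduction when `Im(ω₂/ω₁) > 0`: with `τ₀ = ω₂/ω₁` and `γ ∈ SL₂(ℤ)` such that
`Im(γτ₀) ≥ 1/2`, put `τ = γτ₀`, `ω = ω₁ · (cτ₀ + d)`; then `G_k(Λ) = ω^{-k} 2ζ(k)E_k(τ)` and
`covol(Λ) = |ω|² Im τ`. (Silverman 1986, §2: "we choose our `τ_v`'s in the usual fundamental
domain".) [folklore] -/
private theorem exists_normalForm_of_im_pos (L : PeriodPair) (h : 0 < (L.ω₂ / L.ω₁).im) :
    ∃ (ω : ℂ) (τ : ℍ), ω ≠ 0 ∧ 1 / 2 ≤ τ.im ∧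
      L.G 4 = (ω ^ 4)⁻¹ * (2 * riemannZeta (4 : ℕ) * E₄ τ) ∧
      L.G 6 = (ω ^ 6)⁻¹ * (2 * riemannZeta (6 : ℕ) * E₆ τ) ∧
      ZLattice.covolume L.lattice = ‖ω‖ ^ 2 * τ.im := by
  have hω₁ : L.ω₁ ≠ 0 := by
    rintro h0
    simp [h0] at h
  set τ₀ : ℍ := UpperHalfPlane.mk _ h with hτ₀
  obtain ⟨γ, hγ⟩ := ModularGroup.exists_one_half_le_im_smul τ₀
  have hmem : (γ : GL (Fin 2) ℝ) ∈ 𝒮ℒ := ⟨γ, rfl⟩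
  have hd : denom γ τ₀ ≠ 0 := denom_ne_zero γ τ₀
  refine ⟨L.ω₁ * denom γ τ₀, γ • τ₀, mul_ne_zero hω₁ hd, hγ, ?_, ?_, ?_⟩
  · have h4 := SlashInvariantForm.slash_action_eqn'' E₄ hmem τ₀
    rw [ModularGroup.sl_moeb, h4, G_eq_of_im_pos L h (k := 4) (by norm_num)]
    rw [mul_pow, mul_inv, zpow_ofNat]
    field_simp
    rfl
  · have h6 := SlashInvariantForm.slash_action_eqn'' E₆ hmem τ₀
    rw [ModularGroup.sl_moeb, h6, G_eq_of_im_pos L h (k := 6) (by norm_num)]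
    rw [mul_pow, mul_inv, zpow_ofNat]
    field_simp
    rfl
  · rw [ModularGroup.im_smul_eq_div_normSq, covolume_lattice_eq, norm_mul, mul_pow,
      Complex.sq_norm, Complex.sq_norm]
    field_simp
    rw [show τ₀.im = (L.ω₂ / L.ω₁).im from rfl]
    rw [abs_of_pos]
    · have := im_div_mul_normSq L.ω₁ L.ω₂ hω₁
      linarith
    · have := im_div_mul_normSq L.ω₁ L.ω₂ hω₁
      have hn : 0 < Complex.normSq L.ω₁ := Complex.normSq_pos.mpr hω₁
      nlinarith

/-- **Reduction of an arbitrary period lattice**: `G₄(Λ) = ω⁻⁴ · 2ζ(4) E₄(τ)`,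
`G₆(Λ) = ω⁻⁶ · 2ζ(6) E₆(τ)` and `covol(Λ) = |ω|² Im τ` for some `ω ≠ 0` and `τ ∈ ℍ` with
`Im τ ≥ 1/2` (interchange the periods if `Im(ω₂/ω₁) < 0`). (Silverman AEC C.12; Serre VII §2.2.)
[folklore] -/
private theorem exists_normalForm (L : PeriodPair) :
    ∃ (ω : ℂ) (τ : ℍ), ω ≠ 0 ∧ 1 / 2 ≤ τ.im ∧
      L.G 4 = (ω ^ 4)⁻¹ * (2 * riemannZeta (4 : ℕ) * E₄ τ) ∧
      L.G 6 = (ω ^ 6)⁻¹ * (2 * riemannZeta (6 : ℕ) * E₆ τ) ∧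
      ZLattice.covolume L.lattice = ‖ω‖ ^ 2 * τ.im := by
  have hpos := ZLattice.covolume_pos L.lattice MeasureTheory.volume
  rw [covolume_lattice_eq] at hpos
  have hD : L.ω₁.re * L.ω₂.im - L.ω₁.im * L.ω₂.re ≠ 0 := abs_pos.mp hpos
  rcases lt_or_gt_of_ne hD with hneg | hpos'
  · -- interchange the periods
    have hω₂ : L.ω₂ ≠ 0 := by
      rintro h0
      simp [h0] at hneg
    let L' : PeriodPair :=
      { ω₁ := L.ω₂
        ω₂ := L.ω₁
        indep := by
          rw [LinearIndependent.pair_iff]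
          intro s t hst
          have := (LinearIndependent.pair_iff.mp L.indep) t s (by rw [add_comm]; exact hst)
          exact ⟨this.2, this.1⟩ }
    have hlat : L'.lattice = L.lattice := by
      rw [PeriodPair.lattice, PeriodPair.lattice, Set.pair_comm]
    have hG : ∀ n, L'.G n = L.G n := fun n => by rw [PeriodPair.G, PeriodPair.G, hlat]
    have hc : ZLattice.covolume L'.lattice = ZLattice.covolume L.lattice := by
      rw [covolume_lattice_eq, covolume_lattice_eq, abs_sub_comm]
      congr 1; ring
    have h : 0 < (L'.ω₂ / L'.ω₁).im := by
      have := im_div_mul_normSq L.ω₂ L.ω₁ hω₂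
      have hn : 0 < Complex.normSq L.ω₂ := Complex.normSq_pos.mpr hω₂
      have h' : L.ω₂.re * L.ω₁.im - L.ω₂.im * L.ω₁.re =
          -(L.ω₁.re * L.ω₂.im - L.ω₁.im * L.ω₂.re) := by ring
      exact (mul_pos_iff_of_pos_right hn).mp (by rw [this, h']; linarith)
    obtain ⟨ω, τ, h1, h2, h3, h4, h5⟩ := exists_normalForm_of_im_pos L' h
    exact ⟨ω, τ, h1, h2, (hG 4) ▸ h3, (hG 6) ▸ h4, hc ▸ h5⟩
  · have hω₁ : L.ω₁ ≠ 0 := by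
      rintro h0
      simp [h0] at hpos'
    have h : 0 < (L.ω₂ / L.ω₁).im := by
      have := im_div_mul_normSq L.ω₁ L.ω₂ hω₁
      have hn : 0 < Complex.normSq L.ω₁ := Complex.normSq_pos.mpr hω₁
      exact (mul_pos_iff_of_pos_right hn).mp (by rw [this]; exact hpos')
    exact exists_normalForm_of_im_pos L h

/-! ### The dictionary `c₄ = 16π⁴ω⁻⁴E₄(τ)`, `Δ_V = 2¹²π¹²ω⁻¹²Δ(τ)`, `j_V = E₄³/Δ(τ)` -/

/-- `c₄ = 12 g₂ = 16π⁴ ω⁻⁴ E₄(τ)` for a period lattice in normal form (`g₂ = 60 G₄`,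
`ζ(4) = π⁴/90`; Silverman AEC VI.3.6, C.12). [folklore] -/
private theorem c₄_eq_of_normalForm (V : WeierstrassCurve ℂ) {L : PeriodPair}
    (h₂ : L.g₂ = V.c₄ / 12) {ω : ℂ} {τ : ℍ}
    (hG4 : L.G 4 = (ω ^ 4)⁻¹ * (2 * riemannZeta (4 : ℕ) * E₄ τ)) :
    V.c₄ = 16 * π ^ 4 * (ω ^ 4)⁻¹ * E₄ τ := by
  have h1 := h₂
  rw [PeriodPair.g₂, hG4, Nat.cast_ofNat, riemannZeta_four] at h1
  have : V.c₄ = 12 * (60 * ((ω ^ 4)⁻¹ * (2 * (π ^ 4 / 90) * E₄ τ))) := by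
    rw [h1]; ring
  rw [this]; ring

/-- `c₆ = 216 g₃ = 64π⁶ ω⁻⁶ E₆(τ)` for a period lattice in normal form (`g₃ = 140 G₆`,
`ζ(6) = π⁶/945`; Silverman AEC VI.3.6, C.12). [folklore] -/
private theorem c₆_eq_of_normalForm (V : WeierstrassCurve ℂ) {L : PeriodPair}
    (h₃ : L.g₃ = V.c₆ / 216) {ω : ℂ} {τ : ℍ}
    (hG6 : L.G 6 = (ω ^ 6)⁻¹ * (2 * riemannZeta (6 : ℕ) * E₆ τ)) :
    V.c₆ = 64 * π ^ 6 * (ω ^ 6)⁻¹ * E₆ τ := by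
  have h1 := h₃
  rw [PeriodPair.g₃, hG6, Nat.cast_ofNat, PeriodPair.riemannZeta_six] at h1
  have : V.c₆ = 216 * (140 * ((ω ^ 6)⁻¹ * (2 * (π ^ 6 / 945) * E₆ τ))) := by
    rw [h1]; ring
  rw [this]; ring

/-- `Δ_V = (c₄³ − c₆²)/1728 = 2¹²π¹² ω⁻¹² Δ(τ)` (Mathlib `WeierstrassCurve.c_relation` and
`ModularForm.discriminant_eq_E₄_cube_sub_E₆_sq`; Silverman 1986, §1 "`Δ_v = Δ(τ_v)`").
[folklore] -/
private theorem Δ_eq_of_normalForm (V : WeierstrassCurve ℂ) {L : PeriodPair}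
    (h₂ : L.g₂ = V.c₄ / 12) (h₃ : L.g₃ = V.c₆ / 216) {ω : ℂ} {τ : ℍ}
    (hG4 : L.G 4 = (ω ^ 4)⁻¹ * (2 * riemannZeta (4 : ℕ) * E₄ τ))
    (hG6 : L.G 6 = (ω ^ 6)⁻¹ * (2 * riemannZeta (6 : ℕ) * E₆ τ)) :
    V.Δ = 4096 * π ^ 12 * (ω ^ 12)⁻¹ * ModularForm.discriminant τ := by
  have h := V.c_relation
  rw [c₄_eq_of_normalForm V h₂ hG4, c₆_eq_of_normalForm V h₃ hG6] at h
  rw [ModularForm.discriminant_eq_E₄_cube_sub_E₆_sq]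
  have : V.Δ = ((16 * π ^ 4 * (ω ^ 4)⁻¹ * E₄ τ) ^ 3 -
      (64 * π ^ 6 * (ω ^ 6)⁻¹ * E₆ τ) ^ 2) / 1728 := by
    rw [← h]; ring
  rw [this]
  ring

/-- `|j_V| = |E₄(τ)|³/|Δ(τ)|` in normal form (`j = c₄³/Δ`, `(16π⁴)³ = 2¹²π¹²`). [folklore] -/
private theorem norm_j_eq_of_normalForm (V : WeierstrassCurve ℂ) [V.IsElliptic] {L : PeriodPair}
    (h₂ : L.g₂ = V.c₄ / 12) (h₃ : L.g₃ = V.c₆ / 216) {ω : ℂ} {τ : ℍ} (hω : ω ≠ 0)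
    (hG4 : L.G 4 = (ω ^ 4)⁻¹ * (2 * riemannZeta (4 : ℕ) * E₄ τ))
    (hG6 : L.G 6 = (ω ^ 6)⁻¹ * (2 * riemannZeta (6 : ℕ) * E₆ τ)) :
    ‖V.j‖ = ‖E₄ τ‖ ^ 3 / ‖ModularForm.discriminant τ‖ := by
  have hΔ : V.Δ ≠ 0 := V.isUnit_Δ.ne_zero
  have hd : ModularForm.discriminant τ ≠ 0 := ModularForm.discriminant_ne_zero τ
  have hπ : (π : ℂ) ≠ 0 := Complex.ofReal_ne_zero.mpr Real.pi_ne_zero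
  have hj : V.j = V.c₄ ^ 3 / V.Δ := by
    rw [WeierstrassCurve.j, Units.val_inv_eq_inv_val, WeierstrassCurve.coe_Δ', div_eq_inv_mul]
  rw [hj, c₄_eq_of_normalForm V h₂ hG4, Δ_eq_of_normalForm V h₂ h₃ hG4 hG6]
  rw [norm_div, norm_pow]
  have key : (16 * (π : ℂ) ^ 4 * (ω ^ 4)⁻¹ * E₄ τ) ^ 3 /
      (4096 * π ^ 12 * (ω ^ 12)⁻¹ * ModularForm.discriminant τ) =
      E₄ τ ^ 3 / ModularForm.discriminant τ := by
    field_simp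
    ring
  rw [← norm_pow, ← norm_div, key, norm_div, norm_pow]


/-! ### `q`-disc estimates for level one on `Im τ ≥ 1/2` (Silverman's (4), (5)) -/

/-- A level-one modular form is bounded on `Im τ ≥ 1/2`: its `q`-expansion is continuous on
the closed disc `|q| ≤ e^{−π}`. [folklore] -/
private theorem exists_norm_le_of_one_half_le_im {k : ℤ} {F : Type*} [FunLike F ℍ ℂ]
    [ModularFormClass F 𝒮ℒ k] (f : F) :
    ∃ K : ℝ, ∀ τ : ℍ, 1 / 2 ≤ τ.im → ‖f τ‖ ≤ K := by
  have hcont : ContinuousOn (cuspFunction 1 f) (Metric.closedBall 0 (Real.exp (-π))) := by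
    intro q hq
    refine (ModularFormClass.differentiableAt_cuspFunction f one_pos one_mem_strictPeriods_SL
      ?_).continuousAt.continuousWithinAt
    exact lt_of_le_of_lt (mem_closedBall_zero_iff.mp hq)
      (Real.exp_lt_one_iff.mpr (by linarith [Real.pi_pos]))
  obtain ⟨K, hK⟩ := (isCompact_closedBall (0 : ℂ) _).exists_bound_of_continuousOn hcont
  refine ⟨K, fun τ hτ => ?_⟩
  rw [← SlashInvariantFormClass.eq_cuspFunction f τ one_mem_strictPeriods_SL one_ne_zero]
  apply hK
  rw [mem_closedBall_zero_iff]
  exact Function.Periodic.norm_qParam_le_of_one_half_le_im (by simpa using hτ)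

/-- `|q_τ| = e^{−2π Im τ}`. [folklore] -/
private theorem norm_qParam_one (τ : ℍ) :
    ‖Function.Periodic.qParam 1 τ‖ = Real.exp (-2 * π * τ.im) := by
  rw [Function.Periodic.norm_qParam]
  simp

/-- `|E₄(τ)| ≥ 1/2` for `Im τ ≥ Y`: the `q`-expansion of `E₄` is continuous at `q = 0` with
value `1` (Mathlib `EisensteinSeries.E_qExpansion_coeff_zero`). This is the easy half of
Silverman's (5) ("alright as `τ → i∞`"). [folklore] -/
private theorem exists_one_half_le_norm_E₄ :
    ∃ Y : ℝ, ∀ τ : ℍ, Y ≤ τ.im → 1 / 2 ≤ ‖E₄ τ‖ := by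
  have ha : AnalyticAt ℂ (cuspFunction 1 E₄) 0 :=
    ModularFormClass.analyticAt_cuspFunction_zero E₄ one_pos one_mem_strictPeriods_SL
  have h0 : cuspFunction 1 E₄ 0 = 1 := by
    have := EisensteinSeries.E_qExpansion_coeff_zero (k := 4) (by norm_num) ⟨2, rfl⟩
    rw [qExpansion_coeff] at this
    simpa using this
  have hc := ha.continuousAt
  rw [Metric.continuousAt_iff] at hc
  obtain ⟨δ, hδ, hδ'⟩ := hc (1 / 2) one_half_pos
  refine ⟨-Real.log δ / (2 * π) + 1, fun τ hτ => ?_⟩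
  have hq : ‖Function.Periodic.qParam 1 τ‖ < δ := by
    rw [norm_qParam_one, ← Real.lt_log_iff_exp_lt hδ]
    have hπ : 0 < 2 * π := by positivity
    have : -Real.log δ / (2 * π) < τ.im := by linarith
    rw [div_lt_iff₀ hπ] at this
    linarith
  have h1 := hδ' (x := Function.Periodic.qParam 1 τ) (by simpa using hq)
  rw [SlashInvariantFormClass.eq_cuspFunction E₄ τ one_mem_strictPeriods_SL one_ne_zero, h0,
    dist_eq_norm] at h1
  have := norm_sub_norm_le (1 : ℂ) (E₄ τ)
  rw [norm_one, norm_sub_rev] at this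
  linarith

/-- **Silverman's (4), upper half**: `|Δ(τ)| ≤ K e^{−2π Im τ}` on `Im τ ≥ 1/2` (`Δ` is a cusp
form: exponential decay high in the cusp, Mathlib `CuspFormClass.exp_decay_atImInfty`, and
boundedness on the rest of `Im τ ≥ 1/2`). [folklore] -/
private theorem exists_norm_discriminant_le :
    ∃ K : ℝ, ∀ τ : ℍ, 1 / 2 ≤ τ.im →
      ‖ModularForm.discriminant τ‖ ≤ K * Real.exp (-2 * π * τ.im) := by
  obtain ⟨c, hc⟩ := (CuspFormClass.exp_decay_atImInfty (CuspForm.discriminant) one_pos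
    one_mem_strictPeriods_SL).bound
  obtain ⟨A, hA⟩ := (atImInfty_mem _).mp hc
  obtain ⟨K₀, hK₀⟩ := exists_norm_le_of_one_half_le_im (CuspForm.discriminant)
  refine ⟨max c 0 + max K₀ 0 * Real.exp (2 * π * A), fun τ hτ => ?_⟩
  have hexp : 0 < Real.exp (-2 * π * τ.im) := Real.exp_pos _
  rcases le_or_gt A τ.im with hle | hlt
  · have h1 := hA τ hle
    simp only [Set.mem_setOf_eq, CuspForm.coe_discriminant, div_one, Real.norm_eq_abs,
      abs_of_pos hexp] at h1
    calc ‖ModularForm.discriminant τ‖ ≤ c * Real.exp (-2 * π * τ.im) := h1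
      _ ≤ (max c 0 + max K₀ 0 * Real.exp (2 * π * A)) * Real.exp (-2 * π * τ.im) := by
        gcongr
        calc c ≤ max c 0 := le_max_left _ _
          _ ≤ max c 0 + max K₀ 0 * Real.exp (2 * π * A) :=
              le_add_of_nonneg_right (by positivity)
  · have h1 := hK₀ τ hτ
    simp only [CuspForm.coe_discriminant] at h1
    have h2 : 1 ≤ Real.exp (2 * π * A) * Real.exp (-2 * π * τ.im) := by
      rw [← Real.exp_add]
      apply Real.one_le_exp
      nlinarith [Real.pi_pos]
    calc ‖ModularForm.discriminant τ‖ ≤ max K₀ 0 := h1.trans (le_max_left _ _)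
      _ ≤ max K₀ 0 * (Real.exp (2 * π * A) * Real.exp (-2 * π * τ.im)) :=
          le_mul_of_one_le_right (le_max_right _ _) h2
      _ ≤ (max c 0 + max K₀ 0 * Real.exp (2 * π * A)) * Real.exp (-2 * π * τ.im) := by
          nlinarith [le_max_right c 0, le_max_right K₀ 0, Real.exp_pos (2 * π * A)]

/-- **Silverman's (4), lower half, on a horizontal strip**: `|Δ(τ)| ≥ m > 0` for
`1/2 ≤ Im τ ≤ Y` — the `q`-expansion of `Δ` is continuous and nonvanishing (`Δ = η²⁴ ≠ 0`,
Mathlib `ModularForm.discriminant_ne_zero`) on the compact annulus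
`e^{−2πY} ≤ |q| ≤ e^{−π}`. [folklore] -/
private theorem exists_le_norm_discriminant (Y : ℝ) :
    ∃ m : ℝ, 0 < m ∧ ∀ τ : ℍ, 1 / 2 ≤ τ.im → τ.im ≤ Y → m ≤ ‖ModularForm.discriminant τ‖ := by
  set F := cuspFunction 1 (⇑CuspForm.discriminant) with hF
  set S : Set ℂ := Metric.closedBall 0 (Real.exp (-π)) ∩ {q | Real.exp (-2 * π * Y) ≤ ‖q‖}
  have hScpt : IsCompact S :=
    (isCompact_closedBall (0 : ℂ) _).inter_right (isClosed_le continuous_const continuous_norm)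
  have hS1 : ∀ q ∈ S, ‖q‖ < 1 := fun q hq =>
    lt_of_le_of_lt (mem_closedBall_zero_iff.mp hq.1)
      (Real.exp_lt_one_iff.mpr (by linarith [Real.pi_pos]))
  have hS0 : ∀ q ∈ S, q ≠ 0 := fun q hq => by
    have : 0 < ‖q‖ := lt_of_lt_of_le (Real.exp_pos _) hq.2
    exact norm_pos_iff.mp this
  have hFne : ∀ q ∈ S, F q ≠ 0 := by
    intro q hq
    have him := Function.Periodic.im_invQParam_pos_of_norm_lt_one one_pos (hS1 q hq) (hS0 q hq)
    have := SlashInvariantFormClass.eq_cuspFunction (CuspForm.discriminant)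
      ⟨_, him⟩ one_mem_strictPeriods_SL one_ne_zero
    rw [UpperHalfPlane.coe_mk,
      Function.Periodic.qParam_right_inv one_ne_zero (hS0 q hq)] at this
    rw [hF, this]
    exact ModularForm.discriminant_ne_zero _
  have hcont : ContinuousOn (fun q => (F q)⁻¹) S := by
    refine ContinuousOn.inv₀ (fun q hq => ?_) hFne
    exact (ModularFormClass.differentiableAt_cuspFunction (CuspForm.discriminant) one_pos
      one_mem_strictPeriods_SL (hS1 q hq)).continuousAt.continuousWithinAt
  obtain ⟨B, hB⟩ := hScpt.exists_bound_of_continuousOn hcont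
  refine ⟨1 / max B 1, by positivity, fun τ h1 h2 => ?_⟩
  have hqS : Function.Periodic.qParam 1 τ ∈ S := by
    refine ⟨mem_closedBall_zero_iff.mpr
      (Function.Periodic.norm_qParam_le_of_one_half_le_im (by simpa using h1)), ?_⟩
    simp only [Set.mem_setOf_eq, norm_qParam_one]
    apply Real.exp_le_exp.mpr
    nlinarith [Real.pi_pos]
  have h3 := hB _ hqS
  have h4 := hFne _ hqS
  rw [hF, SlashInvariantFormClass.eq_cuspFunction (CuspForm.discriminant) τ
    one_mem_strictPeriods_SL one_ne_zero] at h3 h4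
  simp only [CuspForm.coe_discriminant, norm_inv] at h3 h4
  rw [div_le_iff₀ (by positivity)]
  have h5 : 0 < ‖ModularForm.discriminant τ‖ := norm_pos_iff.mpr h4
  calc 1 = ‖ModularForm.discriminant τ‖⁻¹ * ‖ModularForm.discriminant τ‖ := by field_simp
    _ ≤ max B 1 * ‖ModularForm.discriminant τ‖ := by
        gcongr
        exact h3.trans (le_max_left _ _)
    _ = ‖ModularForm.discriminant τ‖ * max B 1 := mul_comm _ _

/-! ### Silverman's (4)–(7) for one complex elliptic curve -/

/-- **The archimedean term against `log max(|j|, 1)`** (Silverman 1986, §2, eqs. (4)–(7) with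
Prop. 1.1): there are absolute constants `C₁, C₂` such that for every elliptic curve `V/ℂ`,
`C₁ ≤ log max(|j_V|, 1) + log|Δ_V| + 6 log((i/2)∫ ω_V ∧ ω̄_V) ≤ 6 log(1 + log max(|j_V|, 1)) + C₂`.
In normal form (`exists_normalForm` and the dictionary) the middle quantity is
`log(2¹²π¹²) + log max(|Δ(τ)|, |E₄(τ)|³) + 6 log Im τ` with `Im τ ≥ 1/2`; the bounds are
Silverman's `log|Δ(τ)| = log|q| + O(1)`, `log max(|j(τ)|, 1) = log|1/q| + O(1)` on `Im τ ≥ 1`,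
`O(1)` below, i.e. `Im τ ≤ A(1 + log max(|j|, 1))`.
[cite: Silverman1986, §2 eqs. (4)–(7) (p. 256) with Prop. 1.1] -/
theorem exists_bounds_log_max_j_add_faltingsArchTerm :
    ∃ C₁ C₂ : ℝ, ∀ (V : WeierstrassCurve ℂ) [V.IsElliptic],
      C₁ ≤ Real.log (max ‖V.j‖ 1) + V.faltingsArchTerm ∧
      Real.log (max ‖V.j‖ 1) + V.faltingsArchTerm ≤
        6 * Real.log (1 + Real.log (max ‖V.j‖ 1)) + C₂ := by
  obtain ⟨K₄, hK₄⟩ := exists_norm_le_of_one_half_le_im E₄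
  obtain ⟨KΔ, hKΔ⟩ := exists_norm_le_of_one_half_le_im CuspForm.discriminant
  obtain ⟨Y, hY⟩ := exists_one_half_le_norm_E₄
  obtain ⟨K, hK⟩ := exists_norm_discriminant_le
  obtain ⟨m, hm, hm'⟩ := exists_le_norm_discriminant (max Y 1)
  -- the absolute constants
  set Φ₀ : ℝ := min (1 / 8) m with hΦ₀
  set Φ₁ : ℝ := max (max KΔ 1) (max K₄ 1 ^ 3) with hΦ₁
  set A : ℝ := max Y 1 + |Real.log (8 * max K 1)| / (2 * π) with hA
  have hΦ₀pos : 0 < Φ₀ := lt_min (by norm_num) hm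
  have hA1 : 1 ≤ A := le_trans (le_max_right Y 1) (le_add_of_nonneg_right (by positivity))
  have hApos : 0 < A := lt_of_lt_of_le one_pos hA1
  refine ⟨Real.log (4096 * π ^ 12) + 6 * Real.log (1 / 2) + Real.log Φ₀,
    Real.log (4096 * π ^ 12) + 6 * Real.log A + Real.log Φ₁, ?_⟩
  intro V _
  obtain ⟨L, h₂, h₃⟩ := V.exists_periodPair_of_isElliptic'
  obtain ⟨ω, τ, hω, hτ, hG4, hG6, hcov⟩ := exists_normalForm L
  -- abbreviations
  set y : ℝ := τ.im with hy_def
  set e4 : ℝ := ‖E₄ τ‖ with he4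
  set d : ℝ := ‖ModularForm.discriminant τ‖ with hd_def
  set Φ : ℝ := max d (e4 ^ 3) with hΦ
  set Lj : ℝ := Real.log (max ‖V.j‖ 1) with hLj
  have hy : 1 / 2 ≤ y := hτ
  have hypos : 0 < y := by linarith
  have hd : 0 < d := norm_pos_iff.mpr (ModularForm.discriminant_ne_zero τ)
  have he4nn : 0 ≤ e4 := norm_nonneg _
  have hΦpos : 0 < Φ := lt_max_of_lt_left hd
  have hωpos : 0 < ‖ω‖ := norm_pos_iff.mpr hω
  have hmaxpos : 0 < max ‖V.j‖ 1 := lt_max_of_lt_right one_pos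
  have hLj0 : 0 ≤ Lj := Real.log_nonneg (le_max_right _ _)
  -- the dictionary in `ℝ`: `|j| = e4³/d`, `|Δ_V| = P₃ d`, `covol = |ω|² y`
  have hj : ‖V.j‖ = e4 ^ 3 / d := norm_j_eq_of_normalForm V h₂ h₃ hω hG4 hG6
  set P₃ : ℝ := 4096 * π ^ 12 / ‖ω‖ ^ 12 with hP₃
  have hP₃pos : 0 < P₃ := by positivity
  have hΔn : ‖V.Δ‖ = P₃ * d := by
    rw [Δ_eq_of_normalForm V h₂ h₃ hG4 hG6, hP₃]
    simp [norm_inv, norm_pow, hd_def, div_eq_mul_inv, abs_of_pos Real.pi_pos]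
  have hcp : V.complexPeriod / 2 = ‖ω‖ ^ 2 * y := by
    rw [V.complexPeriod_eq_two_mul_covolume' h₂ h₃, hcov]
    ring
  have hmaxd : max ‖V.j‖ 1 * d = Φ := by
    rw [hj, max_mul_of_nonneg _ _ hd.le, div_mul_cancel₀ _ hd.ne', one_mul, hΦ, max_comm]
  have key : P₃ * (‖ω‖ ^ 2 * y) ^ 6 = 4096 * π ^ 12 * y ^ 6 := by
    rw [hP₃]
    field_simp
  -- `Lj + archTerm = log(4096 π¹²) + log Φ + 6 log y` (Silverman's Prop. 1.1 at one place)
  have hX : Lj + V.faltingsArchTerm = Real.log (4096 * π ^ 12) + Real.log Φ + 6 * Real.log y := by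
    calc Lj + V.faltingsArchTerm
        = Real.log (max ‖V.j‖ 1) + (Real.log (P₃ * d) + 6 * Real.log (‖ω‖ ^ 2 * y)) := by
          rw [hLj, WeierstrassCurve.faltingsArchTerm, hΔn, hcp]
      _ = (Real.log (max ‖V.j‖ 1) + Real.log d) +
            (Real.log P₃ + 6 * Real.log (‖ω‖ ^ 2 * y)) := by
          rw [Real.log_mul hP₃pos.ne' hd.ne']; ring
      _ = Real.log Φ + Real.log (4096 * π ^ 12 * y ^ 6) := by
          rw [← Real.log_mul hmaxpos.ne' hd.ne', hmaxd, ← key,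
            Real.log_mul hP₃pos.ne' (by positivity), Real.log_pow]
          push_cast
          ring
      _ = Real.log (4096 * π ^ 12) + Real.log Φ + 6 * Real.log y := by
          rw [Real.log_mul (by positivity) (by positivity), Real.log_pow]
          push_cast
          ring
  rw [hX]
  constructor
  · -- lower bound: `Φ ≥ Φ₀` and `y ≥ 1/2`
    have hΦ₀Φ : Φ₀ ≤ Φ := by
      rcases le_or_gt (max Y 1) y with h | h
      · have h1 : 1 / 2 ≤ e4 := hY τ ((le_max_left _ _).trans h)
        calc Φ₀ ≤ 1 / 8 := min_le_left _ _
          _ = (1 / 2) ^ 3 := by norm_num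
          _ ≤ e4 ^ 3 := pow_le_pow_left₀ (by norm_num) h1 3
          _ ≤ Φ := le_max_right _ _
      · calc Φ₀ ≤ m := min_le_right _ _
          _ ≤ d := hm' τ hy h.le
          _ ≤ Φ := le_max_left _ _
    have h1 : Real.log Φ₀ ≤ Real.log Φ := Real.log_le_log hΦ₀pos hΦ₀Φ
    have h2 : Real.log (1 / 2) ≤ Real.log y := Real.log_le_log (by norm_num) hy
    linarith
  · -- upper bound: `Φ ≤ Φ₁` and `y ≤ A (1 + Lj)`
    have hΦΦ₁ : Φ ≤ Φ₁ := by
      refine max_le ((hKΔ τ hy).trans ?_) (le_trans ?_ (le_max_right _ _))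
      · exact le_trans (le_max_left _ _) (le_max_left _ _)
      · exact pow_le_pow_left₀ he4nn ((hK₄ τ hy).trans (le_max_left _ _)) 3
    have hyA : y ≤ A * (1 + Lj) := by
      rcases le_or_gt (max Y 1) y with h | h
      · -- high in the cusp: `e^{2πy} ≤ 8 K max(|j(τ)|, 1)` (Silverman's (5))
        have h1 : 1 / 2 ≤ e4 := hY τ ((le_max_left _ _).trans h)
        have h2 : d ≤ K * Real.exp (-2 * π * y) := hK τ hy
        have hexp : 0 < Real.exp (-2 * π * y) := Real.exp_pos _
        have hKpos : 0 < K := by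
          by_contra hK0
          push Not at hK0
          nlinarith
        have h18 : 1 / 8 ≤ e4 ^ 3 :=
          calc (1 / 8 : ℝ) = (1 / 2) ^ 3 := by norm_num
            _ ≤ e4 ^ 3 := pow_le_pow_left₀ (by norm_num) h1 3
        have h6 : Real.exp (2 * π * y) * d ≤ K := by
          have hprod : Real.exp (2 * π * y) * Real.exp (-2 * π * y) = 1 := by
            rw [← Real.exp_add, ← Real.exp_zero]
            congr 1; ring
          calc Real.exp (2 * π * y) * d
              ≤ Real.exp (2 * π * y) * (K * Real.exp (-2 * π * y)) := by gcongr
            _ = K * (Real.exp (2 * π * y) * Real.exp (-2 * π * y)) := by ring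
            _ = K := by rw [hprod, mul_one]
        have hj8 : 1 / (8 * d) ≤ ‖V.j‖ := by
          rw [hj, div_le_div_iff₀ (by positivity) hd]
          nlinarith
        have h5 : Real.exp (2 * π * y) ≤ 8 * K * max ‖V.j‖ 1 :=
          calc Real.exp (2 * π * y) = (Real.exp (2 * π * y) * d) * (1 / d) := by
                field_simp
            _ ≤ K * (1 / d) := by gcongr
            _ = 8 * K * (1 / (8 * d)) := by field_simp
            _ ≤ 8 * K * ‖V.j‖ := by gcongr
            _ ≤ 8 * K * max ‖V.j‖ 1 := by gcongr; exact le_max_left _ _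
        have h7 : 2 * π * y ≤ Real.log (8 * K) + Lj := by
          rw [hLj, ← Real.log_mul (by positivity) hmaxpos.ne', ← Real.log_exp (2 * π * y)]
          exact Real.log_le_log (Real.exp_pos _) h5
        have h8 : Real.log (8 * K) ≤ |Real.log (8 * max K 1)| :=
          le_trans (Real.log_le_log (by positivity) (by gcongr; exact le_max_left _ _))
            (le_abs_self _)
        have hπ : 0 < 2 * π := by positivity
        have hπ1 : 1 ≤ 2 * π := by linarith [Real.two_le_pi]
        set C : ℝ := |Real.log (8 * max K 1)| / (2 * π) with hC
        have h9 : y ≤ C + Lj / (2 * π) := by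
          rw [hC, ← add_div, le_div_iff₀ hπ]; linarith
        have h10 : Lj / (2 * π) ≤ A * Lj :=
          (div_le_self hLj0 hπ1).trans (le_mul_of_one_le_left hLj0 hA1)
        have h11 : 0 ≤ max Y 1 := le_trans zero_le_one (le_max_right _ _)
        have h12 : A * (1 + Lj) = max Y 1 + C + A * Lj := by
          rw [hA, hC]; ring
        linarith
      · calc y ≤ max Y 1 := h.le
          _ ≤ A := le_add_of_nonneg_right (by positivity)
          _ ≤ A * (1 + Lj) := le_mul_of_one_le_right hApos.le (by linarith)
    have h1 : Real.log Φ ≤ Real.log Φ₁ := Real.log_le_log hΦpos hΦΦ₁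
    have h2 : Real.log y ≤ Real.log A + Real.log (1 + Lj) := by
      rw [← Real.log_mul hApos.ne' (by linarith)]
      exact Real.log_le_log hypos hyA
    linarith


end Analytic

/-! ### Assembly: Prop. 2.1 -/

section Assembly

/-- **Silverman 1986, Proposition 2.1 — discharge of `silverman1986_jHeight_faltingsHeight`.**
With `n = [K:ℚ]`: by the closed formula for `h(E/K)` and eq. (10) the middle quantity is
`n⁻¹ Σ_{σ : K → ℂ} F(E_σ)`, `F(V) = log max(|j_V|,1) + log|Δ_V| + 6 log((i/2)∫ω_V∧ω̄_V)`;
`C₁ ≤ F ≤ 6 log(1 + log max(|j_V|, 1)) + C₂` for every complex elliptic curve (eqs. (4)–(7)),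
`n = #(K → ℂ)` (eq. (12)) and Jensen's inequality for `log` (eq. (11)) with
`Σ_σ log max(|σ j|, 1) ≤ log H_K(j)` finish the proof.
[cite: Silverman1986, Prop. 2.1 (p. 257) with Prop. 1.1 and §2 eqs. (4)–(12)] -/
theorem silverman1986_jHeight_faltingsHeight_holds : silverman1986_jHeight_faltingsHeight := by
  obtain ⟨C₁, C₂, hC⟩ := exists_bounds_log_max_j_add_faltingsArchTerm
  refine ⟨C₁, C₂, fun K _ _ W _ => ?_⟩
  -- `n = [K:ℚ] = #(K → ℂ)`
  set n : ℝ := (Module.finrank ℚ K : ℝ) with hn_def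
  have hnpos : 0 < n := by
    rw [hn_def]
    exact_mod_cast Module.finrank_pos (R := ℚ) (M := K)
  have hn : n ≠ 0 := hnpos.ne'
  have hcard : ((Finset.univ : Finset (K →+* ℂ)).card : ℝ) = n := by
    rw [Finset.card_univ, NumberField.Embeddings.card K ℂ]
  -- the per-embedding terms
  set Lσ : (K →+* ℂ) → ℝ := fun σ => Real.log (max ‖σ W.j‖ 1) with hLσ
  set Fσ : (K →+* ℂ) → ℝ := fun σ => Lσ σ + (W.map σ).faltingsArchTerm with hFσ
  have hL0 : ∀ σ, 0 ≤ Lσ σ := fun σ => Real.log_nonneg (le_max_right _ _)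
  -- (8)–(10): the quantity of Prop. 2.1 is `n⁻¹ Σ_σ F_σ`
  have hQ : n⁻¹ * logHeight₁ W.j +
      n⁻¹ * (Real.log (W.minimalDiscriminantNorm (𝓞 K)) -
        Real.log (Ideal.absNorm W.jDenominatorIdeal)) - 12 * W.faltingsHeight =
      n⁻¹ * ∑ σ : K →+* ℂ, Fσ σ := by
    simp only [hFσ, hLσ]
    rw [logHeight₁_j_eq_sum_embeddings, WeierstrassCurve.faltingsHeight, Finset.sum_add_distrib]
    rw [← hn_def]
    field_simp
    ring
  -- (4)–(7) at each embedding
  have hσ : ∀ σ : K →+* ℂ, C₁ ≤ Fσ σ ∧ Fσ σ ≤ 6 * Real.log (1 + Lσ σ) + C₂ := by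
    intro σ
    have h := hC (W.map σ)
    rw [WeierstrassCurve.map_j] at h
    exact h
  -- `Σ_σ L_σ ≤ log H_K(j)` (as `N𝔇 ≥ 1`)
  have hsumL : ∑ σ : K →+* ℂ, Lσ σ ≤ logHeight₁ W.j := by
    rw [logHeight₁_j_eq_sum_embeddings]
    have hD : 0 ≤ Real.log (Ideal.absNorm W.jDenominatorIdeal) := by
      refine Real.log_nonneg ?_
      have h1 : Ideal.absNorm W.jDenominatorIdeal ≠ 0 := by
        rw [Ne, Ideal.absNorm_eq_zero_iff]
        exact W.jDenominatorIdeal_ne_bot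
      exact_mod_cast Nat.one_le_iff_ne_zero.mpr h1
    linarith
  rw [hQ]
  constructor
  · -- lower bound, eq. (12)
    have hlow : ∑ σ : K →+* ℂ, C₁ ≤ ∑ σ : K →+* ℂ, Fσ σ :=
      Finset.sum_le_sum fun σ _ => (hσ σ).1
    rw [Finset.sum_const, nsmul_eq_mul, hcard] at hlow
    calc C₁ = n⁻¹ * (n * C₁) := by field_simp
      _ ≤ n⁻¹ * ∑ σ : K →+* ℂ, Fσ σ := by gcongr
  · -- upper bound, eqs. (11), (12)
    have hup : ∑ σ : K →+* ℂ, Fσ σ ≤ 6 * ∑ σ : K →+* ℂ, Real.log (1 + Lσ σ) + n * C₂ := by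
      calc ∑ σ : K →+* ℂ, Fσ σ ≤ ∑ σ : K →+* ℂ, (6 * Real.log (1 + Lσ σ) + C₂) :=
            Finset.sum_le_sum fun σ _ => (hσ σ).2
        _ = 6 * ∑ σ : K →+* ℂ, Real.log (1 + Lσ σ) + n * C₂ := by
            rw [Finset.sum_add_distrib, Finset.sum_const, nsmul_eq_mul, hcard, ← Finset.mul_sum]
    -- Jensen: `Σ n⁻¹ log(1 + L_σ) ≤ log(Σ n⁻¹ (1 + L_σ)) = log(1 + n⁻¹ Σ L_σ)`
    have hJ : ∑ σ : K →+* ℂ, n⁻¹ • Real.log (1 + Lσ σ) ≤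
        Real.log (∑ σ : K →+* ℂ, n⁻¹ • (1 + Lσ σ)) :=
      (strictConcaveOn_log_Ioi.concaveOn).le_map_sum (t := Finset.univ)
        (fun σ _ => inv_nonneg.mpr hnpos.le)
        (by rw [Finset.sum_const, nsmul_eq_mul, hcard]; field_simp)
        (fun σ _ => Set.mem_Ioi.mpr (by linarith [hL0 σ]))
    simp only [smul_eq_mul] at hJ
    rw [← Finset.mul_sum, ← Finset.mul_sum, Finset.sum_add_distrib, Finset.sum_const,
      nsmul_eq_mul, hcard, mul_add, mul_one, inv_mul_cancel₀ hn] at hJ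
    -- monotonicity of `log`
    have hmono : Real.log (1 + n⁻¹ * ∑ σ : K →+* ℂ, Lσ σ) ≤
        Real.log (1 + n⁻¹ * logHeight₁ W.j) := by
      refine Real.log_le_log ?_ ?_
      · have : 0 ≤ n⁻¹ * ∑ σ : K →+* ℂ, Lσ σ :=
          mul_nonneg (inv_nonneg.mpr hnpos.le) (Finset.sum_nonneg fun σ _ => hL0 σ)
        linarith
      · gcongr
    calc n⁻¹ * ∑ σ : K →+* ℂ, Fσ σ
        ≤ n⁻¹ * (6 * ∑ σ : K →+* ℂ, Real.log (1 + Lσ σ) + n * C₂) := by gcongr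
      _ = 6 * (n⁻¹ * ∑ σ : K →+* ℂ, Real.log (1 + Lσ σ)) + C₂ := by field_simp
      _ ≤ 6 * Real.log (1 + n⁻¹ * ∑ σ : K →+* ℂ, Lσ σ) + C₂ := by gcongr
      _ ≤ 6 * Real.log (1 + n⁻¹ * logHeight₁ W.j) + C₂ := by gcongr

end Assembly

end Literature.NumberTheory.DiophantineGeometry

end
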